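import Mathlib
import HarnessLib
import Summits.ResolutionOfSingularities.ResolutionOfSingularities.Theorems.WildQuotientsWildQuotientResolutionJordanFiveFrameDefs
import Summits.ResolutionOfSingularities.ResolutionOfSingularities.Theorems.WildQuotientsWildQuotientResolutionJordanThreeChartsB
import Summits.ResolutionOfSingularities.ResolutionOfSingularities.Theorems.WildQuotientsWildQuotientResolutionToricExitJordanThreeBrickRegular
import Summits.ResolutionOfSingularities.ResolutionOfSingularities.Theorems.WildQuotientsWildQuotientResolutionBlowupChartStalk
import Summits.ResolutionOfSingularities.ResolutionOfSingularities.Theorems.WildQuotientsWildQuotientResolutionBlowupChartRegularPiece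
import Summits.ResolutionOfSingularities.ResolutionOfSingularities.Theorems.WildQuotientsWildQuotientResolutionBlowupLocalExit
import Literature.AlgebraicGeometry.Resolution.BlowupPrincipalCharts
import Literature.AlgebraicGeometry.Resolution.AffineBlowupAlgebra
import Literature.AlgebraicGeometry.Resolution.BlowupChartRsop

/-!
# RUNG V5 brick B8 (regularity half): the terminal chart `V[x_d¹²]` of `Bl_{I₁₂} 𝔸ⁿ` is an affine space

(crux stmt-ResolutionOfSingularities-15640 `WildQuotients.WildQuotientResolution`, line `Sketch`;
chain w45c NEXT RUNG R-T / RUNG V5, res-L1-w45c-lead-1's scaffold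
`JordanFive.jordanFive_hasResolution_of_bricks` (BRICK LIST 2026-08-27T10:32:12Z, binder `HregD` of
`L/res-L1-w45c-lead-1/stubs/J5Bricks.lean`, brick B8 «UNOWNED», taken by res-L1-w45c-stub-3 10:38Z) over
the definitions of p523816 `…JordanFiveFrameDefs` (`JordanFive.gens12 / exps12 / I12 / chart`).
[OURS · L1 W4.5c] — NOT a statement of any manuscript; replaces the role of no printed item.)

`V = Bl_{I₁₂} 𝔸ⁿ`, `I₁₂ = ⟨gens12⟩` the 40 minimal monomials of `(4,3,2,1)`-weight `≥ 12` in
`x_a, x_b, x_c, x_d`; `gens12 3 = x_d¹²` is the SMOOTH vertex. The `J₅` twin of stub-2's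
`JordanFour.isRegularRing_chartRing_I6_c` (p489593) and of stub-5's p500230 `HregC`:

* `JordanFive.isRegularRing_chartRing_gens12_three` — the Rees chart ring `(k[x][I₁₂t])_{(x_d¹²t)}`
  is a polynomial ring, hence regular: by stub-2's presentation engine
  `JordanThree.isRegularRing_chartRing_of_chartData` with the chart map `Θ : x_a ↦ x_ax_d⁸/x_d¹²`,
  `x_b ↦ x_bx_d⁹/x_d¹²`, `x_c ↦ x_cx_d¹⁰/x_d¹²` (the weighted coordinates `u_a = x_a/x_d⁴`,
  `u_b = x_b/x_d³`, `u_c = x_c/x_d²`; `x_ax_d⁸ = g₁₇`, `x_bx_d⁹ = g₂₈`, `x_cx_d¹⁰ = g₃₃`), retracted by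
  `ω : x_a ↦ x_ax_d⁴, x_b ↦ x_bx_d³, x_c ↦ x_cx_d²`; the 40 generator ratios are hit UNIFORMLY:
  `g_j/x_d¹² = Θ(x_a^α x_b^β x_c^γ x_d^{w−12})` for `(α,β,γ,δ) = exps12 j`, `w = 4α+3β+2γ+δ ≥ 12`
  (`JordanFive.twelve_le_weight_exps12`), by the single exponent identity
  `8α + 9β + 10γ + (w − 12) + 12 = 12(α+β+γ) + δ`;
* `JordanFive.isRegularRing_blowupAlgebra_idealSheaf_I12_d`, and the brick
  **`JordanFive.isRegularLocalRing_stalk_of_mem_chart_three`** `: ∀ v ∈ chart k n a b c d 3,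
  IsRegularLocalRing (𝒪_{V,v})` = the binder `HregD` VERBATIM (transport along `reesChartEquiv`,
  `BlowupExit.isRegularRing_blowupAlgebra_map_of_ringEquiv` p498967,
  `BlowupExit.isRegular_blowupChart_of_isRegularRing` p492566, `isRegularLocalRing_stalk_of_mem`).
-/

-- single-problem summit: the doubled namespace component `ResolutionOfSingularities` is forced
set_option linter.dupNamespace false

noncomputable section

open CategoryTheory AlgebraicGeometry TopologicalSpace MvPolynomial IsLocalization HomogeneousLocalization
open Literature.AlgebraicGeometry.Resolution

namespace Summit.ResolutionOfSingularities.ResolutionOfSingularities.Theorems.WildQuotientResolution.JordanFive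

variable (k : Type) [Field k] (n : ℕ) (a b c d : Fin n)

/-- Every entry of the exponent table `exps12` has `(4,3,2,1)`-weight `≥ 12`. [OURS · L1 W4.5c] -/
theorem twelve_le_weight_exps12 (j : Fin 40) :
    12 ≤ 4 * (exps12 j).1 + 3 * (exps12 j).2.1 + 2 * (exps12 j).2.2.1 + (exps12 j).2.2.2 := by
  fin_cases j <;> simp [exps12]

/-- **The terminal chart `D₊(x_d¹² t)` of `Bl_{I₁₂} 𝔸ⁿ` is regular**: its ring is
`k[x][I₁₂/x_d¹²] = k[u_a, u_b, u_c, x_d, (x_s)_{s ∉ {a,b,c,d}}]`, `u_a = x_a/x_d⁴`, `u_b = x_b/x_d³`,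
`u_c = x_c/x_d²` — a polynomial ring in `n` variables (the smooth vertex chart of the
`(4,3,2,1)`-weighted blow-up). [OURS · L1 W4.5c] [folklore] -/
theorem isRegularRing_chartRing_gens12_three (hab : a ≠ b) (hac : a ≠ c) (had : a ≠ d)
    (hbc : b ≠ c) (hbd : b ≠ d) (hcd : c ≠ d) :
    IsRegularRing (chartRing (gens12 k n a b c d) 3) := by
  classical
  set g : Fin 40 → MvPolynomial (Fin n) k := gens12 k n a b c d with hg
  have hg3 : g 3 = X d ^ 12 := rfl
  have hg17 : g 17 = X a * X d ^ 8 := rfl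
  have hg28 : g 28 = X b * X d ^ 9 := rfl
  have hg33 : g 33 = X c * X d ^ 10 := rfl
  have hba : b ≠ a := fun h => hab h.symm
  have hca : c ≠ a := fun h => hac h.symm
  have hcb : c ≠ b := fun h => hbc h.symm
  have hda : d ≠ a := fun h => had h.symm
  have hdb : d ≠ b := fun h => hbd h.symm
  have hdc : d ≠ c := fun h => hcd h.symm
  set L := Localization.Away (g 3)
  set ι := algebraMap (MvPolynomial (Fin n) k) L with hιdef
  have hu : ι (g 3) * Away.invSelf (g 3) = 1 := Away.mul_invSelf (g 3)
  -- the chart map and the substitution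
  let Θ : MvPolynomial (Fin n) k →ₐ[k] L :=
    aeval fun s => if s = a then ι (g 17) * Away.invSelf (g 3)
      else if s = b then ι (g 28) * Away.invSelf (g 3)
      else if s = c then ι (g 33) * Away.invSelf (g 3)
      else ι (X s)
  let ω : MvPolynomial (Fin n) k →ₐ[k] MvPolynomial (Fin n) k :=
    aeval fun s => if s = a then X a * X d ^ 4
      else if s = b then X b * X d ^ 3
      else if s = c then X c * X d ^ 2
      else X s
  have hΘa : Θ (X a) = ι (g 17) * Away.invSelf (g 3) := by simp [Θ]
  have hΘb : Θ (X b) = ι (g 28) * Away.invSelf (g 3) := by simp [Θ, hba]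
  have hΘc : Θ (X c) = ι (g 33) * Away.invSelf (g 3) := by simp [Θ, hca, hcb]
  have hΘs : ∀ s, s ≠ a → s ≠ b → s ≠ c → Θ (X s) = ι (X s) := fun s h1 h2 h3 => by
    simp [Θ, h1, h2, h3]
  have hΘd : Θ (X d) = ι (X d) := hΘs d hda hdb hdc
  have hωa : ω (X a) = X a * X d ^ 4 := by simp [ω]
  have hωb : ω (X b) = X b * X d ^ 3 := by simp [ω, hba]
  have hωc : ω (X c) = X c * X d ^ 2 := by simp [ω, hca, hcb]
  have hωs : ∀ s, s ≠ a → s ≠ b → s ≠ c → ω (X s) = X s := fun s h1 h2 h3 => by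
    simp [ω, h1, h2, h3]
  have hωd : ω (X d) = X d := hωs d hda hdb hdc
  have hωg3 : ω (g 3) = g 3 := by rw [hg3, map_pow, hωd]
  have E := fun (A B : MvPolynomial (Fin n) k) (e e' : ℕ) (h : A * g 3 ^ e' = B * g 3 ^ e) =>
    JordanThree.algebraMap_mul_invSelf_pow_eq (g 3) A B e e' h
  -- the UNIFORM generator identity
  have hmon : ∀ (α β γ δ e : ℕ), 4 * α + 3 * β + 2 * γ + δ = e + 12 →
      Θ (X a ^ α * X b ^ β * X c ^ γ * X d ^ e) =
        ι (X a ^ α * X b ^ β * X c ^ γ * X d ^ δ) * Away.invSelf (g 3) := by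
    intro α β γ δ e hw
    have hN : 8 * α + 9 * β + 10 * γ + e + 12 = 12 * (α + β + γ) + δ := by omega
    have h1 : g 17 ^ α * g 28 ^ β * g 33 ^ γ * X d ^ e * g 3 ^ 1 =
        X a ^ α * X b ^ β * X c ^ γ * X d ^ (8 * α + 9 * β + 10 * γ + e + 12) := by
      rw [hg17, hg28, hg33, hg3]; ring
    have h2 : X a ^ α * X b ^ β * X c ^ γ * X d ^ δ * g 3 ^ (α + β + γ) =
        X a ^ α * X b ^ β * X c ^ γ * X d ^ (12 * (α + β + γ) + δ) := by
      rw [hg3]; ring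
    have key := E (g 17 ^ α * g 28 ^ β * g 33 ^ γ * X d ^ e)
      (X a ^ α * X b ^ β * X c ^ γ * X d ^ δ) (α + β + γ) 1 (by rw [h1, h2, hN])
    rw [pow_one] at key
    rw [map_mul, map_mul, map_mul, map_pow, map_pow, map_pow, map_pow, hΘa, hΘb, hΘc, hΘd, ← key]
    simp only [map_mul, map_pow]
    ring
  refine JordanThree.isRegularRing_chartRing_of_chartData g 3 ?_ Θ ω ?_ ?_ ?_ ?_ ?_
  · rw [hg3]; exact pow_ne_zero _ (X_ne_zero d)
  · intro s
    by_cases h1 : s = a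
    · subst h1
      rw [hωa, map_mul, map_pow, hΘa, hΘd]
      have key := E (g 17 * X d ^ 4) (X s) 1 0 (by rw [hg17, hg3]; ring)
      rw [pow_one, pow_zero, mul_one, map_mul, map_pow] at key
      rw [← key]
      ring
    by_cases h2 : s = b
    · subst h2
      rw [hωb, map_mul, map_pow, hΘb, hΘd]
      have key := E (g 28 * X d ^ 3) (X s) 1 0 (by rw [hg28, hg3]; ring)
      rw [pow_one, pow_zero, mul_one, map_mul, map_pow] at key
      rw [← key]
      ring
    by_cases h3 : s = c
    · subst h3
      rw [hωc, map_mul, map_pow, hΘc, hΘd]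
      have key := E (g 33 * X d ^ 2) (X s) 1 0 (by rw [hg33, hg3]; ring)
      rw [pow_one, pow_zero, mul_one, map_mul, map_pow] at key
      rw [← key]
      ring
    · rw [hωs s h1 h2 h3, hΘs s h1 h2 h3]
  · intro s
    by_cases h1 : s = a
    · subst h1; rw [hΘa]
      exact div_mem_blowupAlgebra _ _ (Ideal.mem_span_range_self (f := g) (x := 17))
    by_cases h2 : s = b
    · subst h2; rw [hΘb]
      exact div_mem_blowupAlgebra _ _ (Ideal.mem_span_range_self (f := g) (x := 28))
    by_cases h3 : s = c
    · subst h3; rw [hΘc]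
      exact div_mem_blowupAlgebra _ _ (Ideal.mem_span_range_self (f := g) (x := 33))
    · rw [hΘs s h1 h2 h3]
      exact Subalgebra.algebraMap_mem _ _
  · intro j
    refine ⟨X a ^ (exps12 j).1 * X b ^ (exps12 j).2.1 * X c ^ (exps12 j).2.2.1 *
      X d ^ (4 * (exps12 j).1 + 3 * (exps12 j).2.1 + 2 * (exps12 j).2.2.1 + (exps12 j).2.2.2 - 12), ?_⟩
    have hgj : g j = X a ^ (exps12 j).1 * X b ^ (exps12 j).2.1 * X c ^ (exps12 j).2.2.1 *
        X d ^ (exps12 j).2.2.2 := gens12_eq_monomial k n a b c d j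
    rw [hgj]
    exact hmon _ _ _ _ _ (by have := twelve_le_weight_exps12 j; omega)
  · exact ⟨1, 1, by rw [hωg3, mul_one, pow_one]⟩
  · intro s
    by_cases h1 : s = a
    · subst h1
      refine ⟨g 17, 1, by rw [hΘa, pow_one], ?_⟩
      rw [pow_one, hωg3, hg17, hg3, map_mul, map_pow, hωa, hωd]
      ring
    by_cases h2 : s = b
    · subst h2
      refine ⟨g 28, 1, by rw [hΘb, pow_one], ?_⟩
      rw [pow_one, hωg3, hg28, hg3, map_mul, map_pow, hωb, hωd]
      ring
    by_cases h3 : s = c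
    · subst h3
      refine ⟨g 33, 1, by rw [hΘc, pow_one], ?_⟩
      rw [pow_one, hωg3, hg33, hg3, map_mul, map_pow, hωc, hωd]
      ring
    · exact ⟨X s, 0, by rw [hΘs s h1 h2 h3, pow_zero, mul_one],
        by rw [pow_zero, mul_one, hωs s h1 h2 h3]⟩

/-- **The affine blowup algebra of the chart `V[x_d¹²]` of `Bl_{I₁₂} 𝔸ⁿ` is a regular ring**:
`Γ(𝔸ⁿ, ⊤)[Ĩ₁₂(⊤)/x_d¹²] ≅ k[x][I₁₂/x_d¹²] ≅ (k[x][I₁₂t])_{(x_d¹²t)}`, the last ring being regular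
(`isRegularRing_chartRing_gens12_three`). [OURS · L1 W4.5c] [folklore; assembly of landed decls] -/
theorem isRegularRing_blowupAlgebra_idealSheaf_I12_d (hab : a ≠ b) (hac : a ≠ c) (had : a ≠ d)
    (hbc : b ≠ c) (hbd : b ≠ d) (hcd : c ≠ d) :
    IsRegularRing (blowupAlgebra
      ((affineBlowup.idealSheaf (I12 k n a b c d)).ideal ⟨⊤, isAffineOpen_top _⟩)
      ((Scheme.ΓSpecIso (CommRingCat.of (MvPolynomial (Fin n) k))).inv.hom (gens12 k n a b c d 3))) := by
  have hx3 : gens12 k n a b c d 3 ∈ I12 k n a b c d := gens12_mem_I12 k n a b c d 3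
  haveI : IsRegularRing (Away (reesGrading (I12 k n a b c d)) (reesT (gens12 k n a b c d 3) hx3)) :=
    isRegularRing_chartRing_gens12_three k n a b c d hab hac had hbc hbd hcd
  have h1 : IsRegularRing (blowupAlgebra (I12 k n a b c d) (gens12 k n a b c d 3)) :=
    IsRegularRing.of_ringEquiv
      (R := Away (reesGrading (I12 k n a b c d)) (reesT (gens12 k n a b c d 3) hx3))
      (reesChartEquiv (gens12 k n a b c d 3) hx3)
  have h2 := BlowupExit.isRegularRing_blowupAlgebra_map_of_ringEquiv
    (Scheme.ΓSpecIso (CommRingCat.of (MvPolynomial (Fin n) k))).commRingCatIsoToRingEquiv.symm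
    (Scheme.ΓSpecIso (CommRingCat.of (MvPolynomial (Fin n) k))).inv.hom (fun _ => rfl)
    (I12 k n a b c d) (gens12 k n a b c d 3) h1
  have hIdeal : (affineBlowup.idealSheaf (I12 k n a b c d)).ideal ⟨⊤, isAffineOpen_top _⟩ =
      (I12 k n a b c d).map (Scheme.ΓSpecIso (CommRingCat.of (MvPolynomial (Fin n) k))).inv.hom := by
    change (Scheme.IdealSheafData.ofIdealTop _).ideal ⟨⊤, isAffineOpen_top _⟩ = _
    rw [ideal_ofIdealTop_top]
  rw [hIdeal]
  exact h2

/-- **Brick `HregD` of the RUNG V5 scaffold** (binder VERBATIM): every point of the terminal chart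
`V[x_d¹²] = chart 3` of `V = Bl_{I₁₂} 𝔸ⁿ` has a regular local ring. [OURS · L1 W4.5c]
[folklore; assembly of landed decls] -/
theorem isRegularLocalRing_stalk_of_mem_chart_three (hab : a ≠ b) (hac : a ≠ c) (had : a ≠ d)
    (hbc : b ≠ c) (hbd : b ≠ d) (hcd : c ≠ d) :
    ∀ v ∈ chart k n a b c d 3,
      IsRegularLocalRing ((affineBlowup (I12 k n a b c d)).presheaf.stalk v) := by
  intro v hv
  have hIdeal : (affineBlowup.idealSheaf (I12 k n a b c d)).ideal ⟨⊤, isAffineOpen_top _⟩ =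
      (I12 k n a b c d).map (Scheme.ΓSpecIso (CommRingCat.of (MvPolynomial (Fin n) k))).inv.hom := by
    change (Scheme.IdealSheafData.ofIdealTop _).ideal ⟨⊤, isAffineOpen_top _⟩ = _
    rw [ideal_ofIdealTop_top]
  have hx3 : (Scheme.ΓSpecIso (CommRingCat.of (MvPolynomial (Fin n) k))).inv.hom
      (gens12 k n a b c d 3) ∈
      (affineBlowup.idealSheaf (I12 k n a b c d)).ideal ⟨⊤, isAffineOpen_top _⟩ := by
    rw [hIdeal]
    exact Ideal.mem_map_of_mem _ (gens12_mem_I12 k n a b c d 3)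
  exact BlowupExit.isRegularLocalRing_stalk_of_mem _
    (BlowupExit.isRegular_blowupChart_of_isRegularRing (affineBlowup.isBlowup _)
      ⟨⊤, isAffineOpen_top _⟩ hx3
      (isRegularRing_blowupAlgebra_idealSheaf_I12_d k n a b c d hab hac had hbc hbd hcd))
    v hv

end Summit.ResolutionOfSingularities.ResolutionOfSingularities.Theorems.WildQuotientResolution.JordanFive

end
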